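import Literature.NumberTheory.Rogawski1990.SingularObstruction
import Literature.NumberTheory.GaloisRepresentations.QuadraticArtinIndicator
import HarnessLib

/-!
# The singular obstruction IS the quadratic Artin symbol of `L ∕ L⁺` at the descended block-determinant idèle:
# `obs_s(p) = [W]_{L⁺, θ}`, hence `obs_s(p) = 0 ⟺ W = (k) · N_{L∕L⁺}(Z)` (Rogawski 1990, §3.8 Prop. 3.8.1 (d) p. 37; O'Meara 65:2;
# Cassels–Fröhlich VII §7.3 (a))

Topic `NumberTheory/Rogawski1990`; namespace `Literature.NumberTheory.Rogawski1990`; **THEOREMS ONLY** (no definition, no named fact, no instance,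
no notation, no `sorry`).  Cell `pub/hodgecm-mathlib`, ENGINE T1 (crux H413 = `stmt-HodgeConjecture-24833`), O7 singular classes: second kernel-lane
sequel of ★ `SingularObstruction` — the (P4-s) CLASS-FIELD-THEORY reading of `MatchingAdeleG₂.singularObs` asked for by the O7 owner (WORD #9 (4)):
the `𝔸_L`-side predicate ★ `IsPrincipalAdelicNorm` («`δ = (k ⊗ 1) · σ𝔸(z) z`, `k ∈ L⁺ˣ`, `z ∈ 𝔸_Lˣ`») is, on the idèle `W ∈ 𝕀_{L⁺}` DESCENDED from
`δ` (`con W = δ`; it exists and is unique since `δ` is a `c`-fixed adelic unit, ★ `AdeleRing.mem_range_ideleBaseChange_of_forall_smul_eq`, Galois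
descent of idèles [CasselsFrohlichANT1967, VII §7.3 (a)]), the membership `W ∈ (L⁺)ˣ · N_{L∕L⁺}(𝕀_L)` — whence `obs_s(p)` equals B-p12's ★
`quadraticArtinIndicator L⁺ θ W` (`θ = cmQuadraticGenerator L`, `L = L⁺(√θ)`; ★ O'Meara 65:2 `range_ideleRelNorm_maximalRealSubfield_eq`:
`N(𝕀_L) = normIdeles L⁺ θ`).  Mirror, for the ONE quadratic extension `L ∕ L⁺` of the singular road, of the regular road's ★
`MatchingAdeleG₂.cartanObsFun_eq_quadraticArtinIndicator` (one τ-stable factor of the Cartan algebra at a time).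

* §1 `exists_ideleBaseChange_eq_of_adeleConj_eq` (descent of a `c`-fixed adelic unit), **`exists_ideleBaseChange_eq_adelicBlockDet`** (the block
  determinant descends), **`isPrincipalAdelicNorm_iff_mem_sup`** (`IsPrincipalAdelicNorm L δ ↔ W ∈ principalIdeles L⁺ ⊔ range N_{L∕L⁺}` for `con W = δ`;
  ★ `AdeleRing.ideleBaseChange_ideleRelNorm` + ★ `ideleGalNorm_eq_mul_complexConj_smul`: `con (N Z) = Z · c • Z`, injectivity of `con`).
* §2 **`MatchingAdeleG₂.singularObs_eq_quadraticArtinIndicator (hg) (W) (hW)`** and **`MatchingAdeleG₂.singularObs_eq_zero_iff_exists_ideleRelNorm`**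
  (`obs_s(p) = 0 ↔ ∃ k Z, W = (k) · N_{L∕L⁺} Z` — the input shape of B-p12's (P2-s) `exists_totallyPositive_mul_ideleRelNorm_eq`),
  `…_eq_zero_iff_mem_sup_normIdeles` (the PLACEWISE reading: `W ∈ (L⁺)ˣ · normIdeles L⁺ θ`, local norms at every place).

## References
* [Rogawski1990] J. D. Rogawski, *Automorphic Representations of Unitary Groups in Three Variables*, Ann. of Math. Stud. 123 (1990), §3.8 Prop. 3.8.1 (d)
  p. 37; §3.5 Prop. 3.5.2 (c) p. 29.
* [Omeara1963] O. T. O'Meara, *Introduction to Quadratic Forms* (1963), §65A Example 65:2.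
* [CasselsFrohlichANT1967] Cassels–Fröhlich (eds.), *Algebraic Number Theory* (1967), Ch. VII §5.1 (B), §7.3 (a).
-/

set_option autoImplicit false

noncomputable section

open NumberField IsDedekindDomain
open scoped Matrix MatrixGroups

namespace Literature.NumberTheory.Rogawski1990

open Literature.NumberTheory.Automorphic Literature.NumberTheory.GaloisRepresentations Literature.LinearAlgebra.Matrix
open Literature.AlgebraicGeometry.ShimuraVarieties (unitaryGroup mem_unitaryGroup_iff)

variable {L : Type} [Field L] [NumberField L] [IsCMField L]

/-! ## §1 Descent of the block determinant and the dictionary «global × norm» ↔ `(L⁺)ˣ · N(𝕀_L)` -/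

section Descent

/-- **A `c`-fixed adelic unit of `L` descends to an idèle of `L⁺`** (`𝕀_L^{⟨c⟩} = con 𝕀_{L⁺}`, ★ `AdeleRing.mem_range_ideleBaseChange_of_forall_smul_eq`
with `Aut(L∕L⁺) = {1, c}`, ★ `univ_algEquiv_maximalRealSubfield_eq_pair`). [cite: CasselsFrohlichANT1967, Ch. VII §7.3 (a)] -/
theorem exists_ideleBaseChange_eq_of_adeleConj_eq {δ : AdeleRing (𝓞 L) L} (hδ : IsUnit δ) (hc : adeleConj L δ = δ) :
    ∃ W : (AdeleRing (𝓞 ↥(maximalRealSubfield L)) ↥(maximalRealSubfield L))ˣ,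
      ((AdeleRing.ideleBaseChange (↥(maximalRealSubfield L)) L W : (AdeleRing (𝓞 L) L)ˣ) : AdeleRing (𝓞 L) L) = δ := by
  classical
  have hy : ∀ σ : L ≃ₐ[↥(maximalRealSubfield L)] L, σ • hδ.unit = hδ.unit := by
    intro σ
    have hσ : σ ∈ (Finset.univ : Finset (L ≃ₐ[↥(maximalRealSubfield L)] L)) := Finset.mem_univ σ
    rw [univ_algEquiv_maximalRealSubfield_eq_pair L, Finset.mem_insert, Finset.mem_singleton] at hσ
    rcases hσ with rfl | rfl
    · exact one_smul _ _
    · ext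
      rw [AdeleRing.coe_smul_units, IsUnit.unit_spec, ← adeleConj_apply, hc]
  obtain ⟨W, hW⟩ := AdeleRing.mem_range_ideleBaseChange_of_forall_smul_eq (↥(maximalRealSubfield L)) L hy
  exact ⟨W, by rw [hW, IsUnit.unit_spec]⟩

variable {H : Matrix (Fin 3) (Fin 3) L} {γ₀ : (UnitaryGroup.cmDatum L 3 H).Rational} {a b : L}

/-- **The block determinant of the adelic Cartan class DESCENDS to an idèle `W ∈ 𝕀_{L⁺}`** (`con W = blockDet (e ⊗ 1) x_g`): it is a `σ𝔸`-fixed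
adelic unit (★ `adeleConj_adelicBlockDet`, ★ `isUnit_adelicBlockDet`).  `W` is unique (★ `AdeleRing.ideleBaseChange_injective`).
[cite: Rogawski1990, §3.8 Prop. 3.8.1 (d) p. 37] [cite: CasselsFrohlichANT1967, Ch. VII §7.3 (a)] -/
theorem exists_ideleBaseChange_eq_adelicBlockDet (hH : (H.map (cmConjRingHom L))ᵀ = H) (hHd : IsUnit H.det) (hab : a ≠ b)
    (ha : a * cmConjRingHom L a = 1) (hb : b * cmConjRingHom L b = 1)
    (hγ₀ : ((((γ₀ : unitaryGroup (cmConjRingHom L) H).val : GL (Fin 3) L) : Matrix (Fin 3) (Fin 3) L) - a • (1 : Matrix (Fin 3) (Fin 3) L)) *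
      ((((γ₀ : unitaryGroup (cmConjRingHom L) H).val : GL (Fin 3) L) : Matrix (Fin 3) (Fin 3) L) - b • (1 : Matrix (Fin 3) (Fin 3) L)) = 0)
    (p : MatchingAdeleG₂ L H H γ₀) {g : GL (Fin 3) (AdeleRing (𝓞 L) L)}
    (hg : g * (((UnitaryGroup.cmDatum L 3 H).toAdelic γ₀).val : GL (Fin 3) (AdeleRing (𝓞 L) L)) * g⁻¹ = (p.adele.val : GL (Fin 3) (AdeleRing (𝓞 L) L))) :
    ∃ W : (AdeleRing (𝓞 ↥(maximalRealSubfield L)) ↥(maximalRealSubfield L))ˣ,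
      ((AdeleRing.ideleBaseChange (↥(maximalRealSubfield L)) L W : (AdeleRing (𝓞 L) L)ˣ) : AdeleRing (𝓞 L) L) = adelicBlockDet γ₀ a b g :=
  exists_ideleBaseChange_eq_of_adeleConj_eq (isUnit_adelicBlockDet hHd hab hγ₀ p hg) (adeleConj_adelicBlockDet hH hHd hab ha hb hγ₀ g)

/-- `con ((k) · N Z) = (k ⊗ 1) · (c • Z · Z)` in `𝔸_L` (★ `AdeleRing.ideleBaseChange_ideleRelNorm`, ★ `ideleGalNorm_eq_mul_complexConj_smul`,
★ `AdeleRing.baseChange_algebraMap`). [cite: CasselsFrohlichANT1967, Ch. VII §7.3 (a)] -/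
theorem coe_ideleBaseChange_principal_mul_ideleRelNorm_cm (k : (↥(maximalRealSubfield L))ˣ) (z : (AdeleRing (𝓞 L) L)ˣ) :
    ((AdeleRing.ideleBaseChange (↥(maximalRealSubfield L)) L
        (Units.map (algebraMap (↥(maximalRealSubfield L)) (AdeleRing (𝓞 ↥(maximalRealSubfield L)) ↥(maximalRealSubfield L)) :
          ↥(maximalRealSubfield L) →* AdeleRing (𝓞 ↥(maximalRealSubfield L)) ↥(maximalRealSubfield L)) k *
          AdeleRing.ideleRelNorm (↥(maximalRealSubfield L)) L z) : (AdeleRing (𝓞 L) L)ˣ) : AdeleRing (𝓞 L) L) =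
      algebraMap L (AdeleRing (𝓞 L) L) (algebraMap (↥(maximalRealSubfield L)) L k) * (adeleConj L (z : AdeleRing (𝓞 L) L) * (z : AdeleRing (𝓞 L) L)) := by
  rw [map_mul, AdeleRing.ideleBaseChange_ideleRelNorm, ideleGalNorm_eq_mul_complexConj_smul, Units.val_mul, Units.val_mul,
    AdeleRing.coe_ideleBaseChange, Units.coe_map, MonoidHom.coe_coe, AdeleRing.baseChange_algebraMap, AdeleRing.coe_smul_units,
    ← adeleConj_apply, mul_comm (z : AdeleRing (𝓞 L) L)]

/-- **THE DICTIONARY**: for an idèle `W` of `L⁺` with `con W = δ`, «`δ` is GLOBAL × NORM in `𝔸_L`» iff `W ∈ (L⁺)ˣ · N_{L∕L⁺}(𝕀_L)`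
(injectivity of `con`; `k ∈ L` with `c k = k ≠ 0` is an element of `L⁺ˣ`). [cite: CasselsFrohlichANT1967, Ch. VII §7.3 (a), §5.1 (B)]
[cite: Rogawski1990, §3.8 Prop. 3.8.1 (d) p. 37] -/
theorem isPrincipalAdelicNorm_iff_mem_sup (W : (AdeleRing (𝓞 ↥(maximalRealSubfield L)) ↥(maximalRealSubfield L))ˣ) {δ : AdeleRing (𝓞 L) L}
    (hW : ((AdeleRing.ideleBaseChange (↥(maximalRealSubfield L)) L W : (AdeleRing (𝓞 L) L)ˣ) : AdeleRing (𝓞 L) L) = δ) :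
    IsPrincipalAdelicNorm L δ ↔
      W ∈ principalIdeles ↥(maximalRealSubfield L) ⊔ (AdeleRing.ideleRelNorm (↥(maximalRealSubfield L)) L).range := by
  constructor
  · rintro ⟨k, z, hk0, hkc, hδ⟩
    have hkmem : k ∈ maximalRealSubfield L := (IsCMField.complexConj_eq_self_iff L k).1 (by rw [← cmConjRingHom_apply]; exact hkc)
    have hk0' : (⟨k, hkmem⟩ : ↥(maximalRealSubfield L)) ≠ 0 := fun h => hk0 (congrArg Subtype.val h)
    set k₀ : (↥(maximalRealSubfield L))ˣ := Units.mk0 ⟨k, hkmem⟩ hk0' with hk₀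
    have hWeq : W = Units.map (algebraMap (↥(maximalRealSubfield L)) (AdeleRing (𝓞 ↥(maximalRealSubfield L)) ↥(maximalRealSubfield L)) :
          ↥(maximalRealSubfield L) →* AdeleRing (𝓞 ↥(maximalRealSubfield L)) ↥(maximalRealSubfield L)) k₀ *
        AdeleRing.ideleRelNorm (↥(maximalRealSubfield L)) L z := by
      apply AdeleRing.ideleBaseChange_injective (↥(maximalRealSubfield L)) L
      apply Units.ext
      rw [hW, coe_ideleBaseChange_principal_mul_ideleRelNorm_cm, hδ, hk₀, Units.val_mk0]
      rfl
    rw [hWeq]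
    exact Subgroup.mul_mem_sup ⟨k₀, rfl⟩ ⟨z, rfl⟩
  · intro h
    obtain ⟨P, hP, N, hN, hPN⟩ := Subgroup.mem_sup.1 h
    obtain ⟨k₀, rfl⟩ := hP
    obtain ⟨z, rfl⟩ := hN
    refine ⟨algebraMap (↥(maximalRealSubfield L)) L k₀, z, ?_, ?_, ?_⟩
    · exact fun h0 => k₀.ne_zero ((algebraMap (↥(maximalRealSubfield L)) L).injective (h0.trans (map_zero _).symm))
    · rw [cmConjRingHom_apply]
      exact (IsCMField.complexConj_eq_self_iff L _).2 (k₀ : ↥(maximalRealSubfield L)).2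
    · rw [← hW, ← hPN, coe_ideleBaseChange_principal_mul_ideleRelNorm_cm]

end Descent

/-! ## §2 `obs_s = [W]_{L⁺, θ}` and the class-field-theory readings -/

section Indicator

variable {H : Matrix (Fin 3) (Fin 3) L} {γ₀ : (UnitaryGroup.cmDatum L 3 H).Rational} {a b : L}

/-- **`obs_s(p) = [W]_{L⁺, θ}`** — the singular obstruction of `p` equals the QUADRATIC ARTIN SYMBOL of `L = L⁺(√θ)` at the idèle `W ∈ 𝕀_{L⁺}`
descended from the block determinant of (any) adelic conjugator `g` of `p` (`con W = blockDet (e ⊗ 1) x_g`; `θ = cmQuadraticGenerator L`):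
`0 ↔` «global × norm» (★ `singularObs_eq_zero_iff`) `↔ W ∈ (L⁺)ˣ · N(𝕀_L)` (`isPrincipalAdelicNorm_iff_mem_sup`) `= (L⁺)ˣ · normIdeles L⁺ θ` (★ O'Meara 65:2
`range_ideleRelNorm_maximalRealSubfield_eq`) `↔ [W] = 0`. [cite: Rogawski1990, §3.8 Prop. 3.8.1 (d) p. 37; §3.5 Prop. 3.5.2 (c) p. 29]
[cite: Omeara1963, §65A Example 65:2] -/
theorem MatchingAdeleG₂.singularObs_eq_quadraticArtinIndicator (hHd : IsUnit H.det) (hab : a ≠ b) (ha : a * cmConjRingHom L a = 1)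
    (hb : b * cmConjRingHom L b = 1)
    (hγ₀ : ((((γ₀ : unitaryGroup (cmConjRingHom L) H).val : GL (Fin 3) L) : Matrix (Fin 3) (Fin 3) L) - a • (1 : Matrix (Fin 3) (Fin 3) L)) *
      ((((γ₀ : unitaryGroup (cmConjRingHom L) H).val : GL (Fin 3) L) : Matrix (Fin 3) (Fin 3) L) - b • (1 : Matrix (Fin 3) (Fin 3) L)) = 0)
    (p : MatchingAdeleG₂ L H H γ₀) {g : GL (Fin 3) (AdeleRing (𝓞 L) L)}
    (hg : g * (((UnitaryGroup.cmDatum L 3 H).toAdelic γ₀).val : GL (Fin 3) (AdeleRing (𝓞 L) L)) * g⁻¹ = (p.adele.val : GL (Fin 3) (AdeleRing (𝓞 L) L)))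
    (W : (AdeleRing (𝓞 ↥(maximalRealSubfield L)) ↥(maximalRealSubfield L))ˣ)
    (hW : ((AdeleRing.ideleBaseChange (↥(maximalRealSubfield L)) L W : (AdeleRing (𝓞 L) L)ˣ) : AdeleRing (𝓞 L) L) = adelicBlockDet γ₀ a b g) :
    p.singularObs hab hγ₀ = quadraticArtinIndicator (↥(maximalRealSubfield L)) (cmQuadraticGenerator L : ↥(maximalRealSubfield L)) W := by
  have hiff : p.singularObs hab hγ₀ = 0 ↔
      quadraticArtinIndicator (↥(maximalRealSubfield L)) (cmQuadraticGenerator L : ↥(maximalRealSubfield L)) W = 0 := by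
    rw [p.singularObs_eq_zero_iff hHd hab ha hb hγ₀ hg, isPrincipalAdelicNorm_iff_mem_sup W hW, quadraticArtinIndicator_eq_zero_iff,
      ← range_ideleRelNorm_maximalRealSubfield_eq]
  rcases p.singularObs_eq_zero_or_eq_one hab hγ₀ with h0 | h1
  · rw [h0]; exact (hiff.1 h0).symm
  · rw [h1]
    by_cases h0' : quadraticArtinIndicator (↥(maximalRealSubfield L)) (cmQuadraticGenerator L : ↥(maximalRealSubfield L)) W = 0
    · exact absurd (hiff.2 h0') (by rw [h1]; exact one_ne_zero)
    · exact (quadraticArtinIndicator_eq_one_iff.2 (fun hmem => h0' (quadraticArtinIndicator_eq_zero_iff.2 hmem))).symm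

/-- **`obs_s(p) = 0 ⟺ W = (k) · N_{L∕L⁺}(Z)`** for a global `k ∈ L⁺ˣ` and an idèle `Z` of `L` — the (P4-s) class-field-theory reading (★
`quadraticArtinIndicator_eq_zero_iff_exists_ideleRelNorm`, O'Meara 65:2), the input shape of the realisation step (P2-s)∕(R6a-s).
[cite: Rogawski1990, §3.8 Prop. 3.8.1 (d) p. 37] [cite: Omeara1963, §65A Example 65:2] [cite: CasselsFrohlichANT1967, Ch. VII §5.1 (B)] -/
theorem MatchingAdeleG₂.singularObs_eq_zero_iff_exists_ideleRelNorm (hHd : IsUnit H.det) (hab : a ≠ b) (ha : a * cmConjRingHom L a = 1)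
    (hb : b * cmConjRingHom L b = 1)
    (hγ₀ : ((((γ₀ : unitaryGroup (cmConjRingHom L) H).val : GL (Fin 3) L) : Matrix (Fin 3) (Fin 3) L) - a • (1 : Matrix (Fin 3) (Fin 3) L)) *
      ((((γ₀ : unitaryGroup (cmConjRingHom L) H).val : GL (Fin 3) L) : Matrix (Fin 3) (Fin 3) L) - b • (1 : Matrix (Fin 3) (Fin 3) L)) = 0)
    (p : MatchingAdeleG₂ L H H γ₀) {g : GL (Fin 3) (AdeleRing (𝓞 L) L)}
    (hg : g * (((UnitaryGroup.cmDatum L 3 H).toAdelic γ₀).val : GL (Fin 3) (AdeleRing (𝓞 L) L)) * g⁻¹ = (p.adele.val : GL (Fin 3) (AdeleRing (𝓞 L) L)))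
    (W : (AdeleRing (𝓞 ↥(maximalRealSubfield L)) ↥(maximalRealSubfield L))ˣ)
    (hW : ((AdeleRing.ideleBaseChange (↥(maximalRealSubfield L)) L W : (AdeleRing (𝓞 L) L)ˣ) : AdeleRing (𝓞 L) L) = adelicBlockDet γ₀ a b g) :
    p.singularObs hab hγ₀ = 0 ↔
      ∃ (k : (↥(maximalRealSubfield L))ˣ) (Z : (AdeleRing (𝓞 L) L)ˣ),
        W = Units.map (algebraMap (↥(maximalRealSubfield L)) (AdeleRing (𝓞 ↥(maximalRealSubfield L)) ↥(maximalRealSubfield L)) :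
          ↥(maximalRealSubfield L) →* AdeleRing (𝓞 ↥(maximalRealSubfield L)) ↥(maximalRealSubfield L)) k *
          AdeleRing.ideleRelNorm (↥(maximalRealSubfield L)) L Z := by
  obtain ⟨α, hα0, hcα, hsq⟩ := cmQuadraticGenerator_spec L
  rw [p.singularObs_eq_quadraticArtinIndicator hHd hab ha hb hγ₀ hg W hW]
  exact quadraticArtinIndicator_eq_zero_iff_exists_ideleRelNorm (IsCMField.complexConj L) hcα hα0 (by rw [← sq]; exact hsq) W

/-- **PLACEWISE reading: `obs_s(p) = 0 ⟺ W ∈ (L⁺)ˣ · normIdeles L⁺ θ`** — a global element times an idèle that is a LOCAL NORM from `L⁺_v(√θ)` at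
every place (★ O'Meara 65:2 `range_ideleRelNorm_maximalRealSubfield_eq`); the form the placewise socket's `hreal` starts from.
[cite: Omeara1963, §65A Example 65:2] [cite: Rogawski1990, §3.8 Prop. 3.8.1 (d) p. 37] -/
theorem MatchingAdeleG₂.singularObs_eq_zero_iff_mem_sup_normIdeles (hHd : IsUnit H.det) (hab : a ≠ b) (ha : a * cmConjRingHom L a = 1)
    (hb : b * cmConjRingHom L b = 1)
    (hγ₀ : ((((γ₀ : unitaryGroup (cmConjRingHom L) H).val : GL (Fin 3) L) : Matrix (Fin 3) (Fin 3) L) - a • (1 : Matrix (Fin 3) (Fin 3) L)) *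
      ((((γ₀ : unitaryGroup (cmConjRingHom L) H).val : GL (Fin 3) L) : Matrix (Fin 3) (Fin 3) L) - b • (1 : Matrix (Fin 3) (Fin 3) L)) = 0)
    (p : MatchingAdeleG₂ L H H γ₀) {g : GL (Fin 3) (AdeleRing (𝓞 L) L)}
    (hg : g * (((UnitaryGroup.cmDatum L 3 H).toAdelic γ₀).val : GL (Fin 3) (AdeleRing (𝓞 L) L)) * g⁻¹ = (p.adele.val : GL (Fin 3) (AdeleRing (𝓞 L) L)))
    (W : (AdeleRing (𝓞 ↥(maximalRealSubfield L)) ↥(maximalRealSubfield L))ˣ)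
    (hW : ((AdeleRing.ideleBaseChange (↥(maximalRealSubfield L)) L W : (AdeleRing (𝓞 L) L)ˣ) : AdeleRing (𝓞 L) L) = adelicBlockDet γ₀ a b g) :
    p.singularObs hab hγ₀ = 0 ↔
      W ∈ principalIdeles ↥(maximalRealSubfield L) ⊔
        Literature.NumberTheory.QuadraticForms.normIdeles ↥(maximalRealSubfield L) (cmQuadraticGenerator L : ↥(maximalRealSubfield L)) := by
  rw [p.singularObs_eq_quadraticArtinIndicator hHd hab ha hb hγ₀ hg W hW, quadraticArtinIndicator_eq_zero_iff]

end Indicator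

end Literature.NumberTheory.Rogawski1990

end
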